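import Summits.HodgeConjecture.CorCM.IrreducibleOddWeightsIndexParityShadowPair
import Summits.HodgeConjecture.CorCM.IrreducibleOddWeightsIndexParityTwisted
import HarnessLib

/-!
# Index parity, VIII (CM fields): TWISTED × TWISTED — two fibre-twisted types (even indices on both sides) are additive as
# soon as the two pivot images `y₀(T₀)`, `y₁(T₁)` meet in a REAL field; their defect space in general

COR-CM (cell `pub-hodgecm2`, binder seat `b16` gen 68, count-neutral claim INDEX PARITY, file P7; theorems only, no
definition, no named fact, no `sorry`).  NEW as stated, hence under `Summits/`.  HONEST FRAMING: Galois theory of CM fields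
inside `ℂ` with consequences for `dim MT(A₀ × A₁)` of abelian varieties with complex multiplication; nothing is claimed about
the algebraicity of Hodge classes; `HC_CM` is neither used nor asserted.

SETTING (P3 `…IndexParityTwisted`, P5 `…IndexParityShadowPair` §2).  Subfields `T₀ ⊆ K_{i₀}`, `T₁ ⊆ K_{i₁}` containing the
traces (TR), embeddings `y₀ : T₀ → ℂ`, `y₁ : T₁ → ℂ`, and types `Φ_{i₀}`, `Φ_{i₁}` with the TWISTED shadows
`[K_{i₀}:T₀]·(δ_{y₀} − δ_{ȳ₀})`, `[K_{i₁}:T₁]·(δ_{y₁} − δ_{ȳ₁})` (they exist whenever both indices are even, P3).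

* `apply_conj_mul_eq_of_left_invariant` — left-invariance passes from the two stabilisers `Aut(ℂ/y₀T₀)`, `Aut(ℂ/y₁T₁)` to the
  subgroup they generate, which contains complex conjugation when `y₀(T₀) ∩ y₁(T₁) ⊂ ℝ` (Galois correspondence in `Aut(ℂ)`,
  tree `mem_closure_fixing_union_of_apply_eq`).
* **`mem_twistedShadowCoeff_inf_twistedShadowCoeff_iff`** — the defect space of the twisted pair is
  `{c | c(hg) = c(g) ∀ h ∈ Aut(ℂ/y₀T₀) ∪ Aut(ℂ/y₁T₁), c(ρg) = −c(g)}` (P3 twice); by P5 §2 its dimension is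
  `dim Hg(A^{(y₀)}) + dim Hg(A^{(y₁)}) − dim Hg(A^{(y₀)} × A^{(y₁)})`.
* **`cmFamilyRank_add_card_eq_of_twisted_pair_of_real`** — if every element of `y₀(T₀) ∩ y₁(T₁)` is REAL then
  **`Hg(A^{(y₀)} × A^{(y₁)}) = Hg(A^{(y₀)}) × Hg(A^{(y₁)})`**: a left-odd function invariant under conjugation vanishes.  (The
  traces themselves may well meet `L₁`, `L₀` in CM fields: the criterion is about the chosen pair of embeddings.)

## References

* [Lang2002] S. Lang, *Algebra*, 3rd ed., VI §1 Thm. 1.1, Cor. 1.6, Thm. 1.12, V §2 Thm. 2.8.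
* [Gordon1999HodgeAVSurvey] B. B. Gordon, *A survey of the Hodge conjecture for abelian varieties*, §3 Theorem, 7.5–7.7.
* [Shimura1998] G. Shimura, *Abelian Varieties with Complex Multiplication and Modular Functions*, §8.1, §18.1.
-/

set_option autoImplicit false

noncomputable section

open scoped BigOperators Classical

open CategoryTheory CategoryTheory.Limits NumberField Module IntermediateField

namespace Summit.HodgeConjecture.CorCM

open Literature.NumberTheory.ComplexMultiplication
open Literature.NumberTheory.NumberFields (mem_closure_fixing_union_of_apply_eq)
open Literature.AlgebraicGeometry.Motives (AbelianVariety CMType)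
open Literature.AlgebraicGeometry.Pohlmann1968

/-! ### §1 Left-invariance along the subgroup generated by two stabilisers -/

section Closure

variable {T₀ : Type} [Field T₀] [NumberField T₀] {T₁ : Type} [Field T₁] [NumberField T₁]

/-- An automorphism of `ℂ` fixes the embedding `y₀` iff it fixes its image field pointwise. [cite: Lang2002, V §2 Thm. 2.8] -/
theorem smul_eq_iff_forall_mem_fieldRange (σ : ℂ ≃+* ℂ) (y₀ : T₀ →+* ℂ) :
    σ • y₀ = y₀ ↔ ∀ z : ℂ, z ∈ y₀.toRatAlgHom.fieldRange → σ z = z := by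
  constructor
  · intro h z hz
    obtain ⟨k, rfl⟩ := AlgHom.mem_fieldRange.1 hz
    have := RingHom.congr_fun h k
    rwa [ringEquiv_smul_apply] at this
  · intro h
    exact RingHom.ext fun k => by
      rw [ringEquiv_smul_apply]
      exact h _ (AlgHom.mem_fieldRange.2 ⟨k, rfl⟩)

/-- **Left-invariance under the two stabilisers extends to the subgroup they generate, which contains conjugation when the
two image fields meet in a real field.** [cite: Lang2002, VI §1 Thm. 1.1, Cor. 1.6 and Thm. 1.12] -/
theorem apply_conj_mul_eq_of_left_invariant (y₀ : T₀ →+* ℂ) (y₁ : T₁ →+* ℂ)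
    (hreal : ∀ z : ℂ, z ∈ y₀.toRatAlgHom.fieldRange → z ∈ y₁.toRatAlgHom.fieldRange → starRingEnd ℂ z = z)
    {c : (ℂ ≃+* ℂ) → ℚ} (h₀ : ∀ h : ℂ ≃+* ℂ, h • y₀ = y₀ → ∀ g : ℂ ≃+* ℂ, c (h * g) = c g)
    (h₁ : ∀ h : ℂ ≃+* ℂ, h • y₁ = y₁ → ∀ g : ℂ ≃+* ℂ, c (h * g) = c g) (g : ℂ ≃+* ℂ) :
    c ((starRingAut : ℂ ≃+* ℂ) * g) = c g := by
  haveI : FiniteDimensional ℚ y₀.toRatAlgHom.fieldRange :=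
    LinearEquiv.finiteDimensional (AlgEquiv.ofInjectiveField y₀.toRatAlgHom).toLinearEquiv
  haveI : FiniteDimensional ℚ y₁.toRatAlgHom.fieldRange :=
    LinearEquiv.finiteDimensional (AlgEquiv.ofInjectiveField y₁.toRatAlgHom).toLinearEquiv
  have hmem := mem_closure_fixing_union_of_apply_eq (E₀ := y₀.toRatAlgHom.fieldRange)
    (E₁ := y₁.toRatAlgHom.fieldRange) (τ := (starRingAut : ℂ ≃+* ℂ)) fun z hz₀ hz₁ => by
      rw [starRingAut_apply, ← starRingEnd_apply]; exact hreal z hz₀ hz₁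
  -- left-invariance holds on the generators, hence on the closure
  have hgen : ∀ n ∈ ({σ : ℂ ≃+* ℂ | ∀ z : ℂ, z ∈ y₀.toRatAlgHom.fieldRange → σ z = z} ∪
      {σ : ℂ ≃+* ℂ | ∀ z : ℂ, z ∈ y₁.toRatAlgHom.fieldRange → σ z = z}), ∀ g : ℂ ≃+* ℂ, c (n * g) = c g := by
    rintro n (hn | hn) g
    · exact h₀ n ((smul_eq_iff_forall_mem_fieldRange n y₀).2 hn) g
    · exact h₁ n ((smul_eq_iff_forall_mem_fieldRange n y₁).2 hn) g
  have key : ∀ n ∈ Subgroup.closure ({σ : ℂ ≃+* ℂ | ∀ z : ℂ, z ∈ y₀.toRatAlgHom.fieldRange → σ z = z} ∪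
      {σ : ℂ ≃+* ℂ | ∀ z : ℂ, z ∈ y₁.toRatAlgHom.fieldRange → σ z = z}), ∀ g : ℂ ≃+* ℂ, c (n * g) = c g := by
    intro n hn
    induction hn using Subgroup.closure_induction with
    | mem n hn => exact hgen n hn
    | one => intro g; rw [one_mul]
    | mul a b _ _ ha hb => intro g; rw [mul_assoc, ha, hb]
    | inv a _ ha =>
      intro g
      have := ha (a⁻¹ * g)
      rw [mul_inv_cancel_left] at this
      exact this.symm
  exact key _ hmem g

end Closure

/-! ### §2 The twisted pair -/

section TwistedPair

variable {I : Type} [Fintype I] {K : I → Type} [∀ i, Field (K i)] [∀ i, NumberField (K i)] [∀ i, IsCMField (K i)]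
  {T₀ : Type} [Field T₀] [NumberField T₀] {T₁ : Type} [Field T₁] [NumberField T₁]

omit [Fintype I] in
/-- **THE DEFECT SPACE OF THE TWISTED PAIR** = the functions on `Aut(ℂ)` that are LEFT-INVARIANT under both stabilisers
`Aut(ℂ/y₀T₀)`, `Aut(ℂ/y₁T₁)` and LEFT-ODD under conjugation (P3's characterisation on both sides); its dimension is the
defect `dim Hg(A^{(y₀)}) + dim Hg(A^{(y₁)}) − dim Hg(A^{(y₀)} × A^{(y₁)})` (P5 §2). [cite: Lang2002, VI §1 Thm. 1.1]
[cite: Gordon1999HodgeAVSurvey, §3 Theorem, 7.5–7.7] -/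
theorem mem_twistedShadowCoeff_inf_twistedShadowCoeff_iff {i₀ i₁ : I} (Φ : ∀ i, CMType (K i)) [Algebra T₀ (K i₀)]
    [Algebra T₁ (K i₁)] (y₀ : T₀ →+* ℂ) (y₁ : T₁ →+* ℂ)
    (htw₀ : ∀ y : T₀ →+* ℂ,
      ∑ t ∈ Finset.univ.filter (fun t : K i₀ →+* ℂ => t.comp (algebraMap T₀ (K i₀)) = y),
          antiVec (Φ i₀).1 (1 : ℂ ≃+* ℂ) t =
        (Module.finrank T₀ (K i₀) : ℚ) *
          ((if y = y₀ then 1 else 0) - (if y = (starRingAut : ℂ ≃+* ℂ) • y₀ then 1 else 0)))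
    (htw₁ : ∀ y : T₁ →+* ℂ,
      ∑ t ∈ Finset.univ.filter (fun t : K i₁ →+* ℂ => t.comp (algebraMap T₁ (K i₁)) = y),
          antiVec (Φ i₁).1 (1 : ℂ ≃+* ℂ) t =
        (Module.finrank T₁ (K i₁) : ℚ) *
          ((if y = y₁ then 1 else 0) - (if y = (starRingAut : ℂ ≃+* ℂ) • y₁ then 1 else 0)))
    (c : (ℂ ≃+* ℂ) → ℚ) :
    c ∈ Submodule.span ℚ (Set.range fun y : T₀ →+* ℂ => fun g : ℂ ≃+* ℂ =>
          ∑ t ∈ Finset.univ.filter (fun t : K i₀ →+* ℂ => t.comp (algebraMap T₀ (K i₀)) = g • y),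
            antiVec (Φ i₀).1 (1 : ℂ ≃+* ℂ) t) ⊓
        Submodule.span ℚ (Set.range fun y : T₁ →+* ℂ => fun g : ℂ ≃+* ℂ =>
          ∑ t ∈ Finset.univ.filter (fun t : K i₁ →+* ℂ => t.comp (algebraMap T₁ (K i₁)) = g • y),
            antiVec (Φ i₁).1 (1 : ℂ ≃+* ℂ) t) ↔
      (∀ h : ℂ ≃+* ℂ, h • y₀ = y₀ → ∀ g : ℂ ≃+* ℂ, c (h * g) = c g) ∧
        (∀ h : ℂ ≃+* ℂ, h • y₁ = y₁ → ∀ g : ℂ ≃+* ℂ, c (h * g) = c g) ∧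
          ∀ g : ℂ ≃+* ℂ, c ((starRingAut : ℂ ≃+* ℂ) * g) = -c g := by
  rw [Submodule.mem_inf, mem_span_twistedShadowCoeff_iff (Φ i₀) y₀ htw₀, mem_span_twistedShadowCoeff_iff (Φ i₁) y₁ htw₁]
  tauto

/-- **TWISTED × TWISTED WITH A REAL INTERSECTION IS ADDITIVE**: `T₀ ⊆ K_{i₀}`, `T₁ ⊆ K_{i₁}` containing the traces, twisted
types at `y₀`, `y₁`, and every element of `y₀(T₀) ∩ y₁(T₁)` real ⟹ `Hg(A^{(y₀)} × A^{(y₁)}) = Hg(A^{(y₀)}) × Hg(A^{(y₁)})`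
(`cmFamilyRank Φ + 2 = cmTypeRank Φ₀ + cmTypeRank Φ₁ + 1`). [cite: Lang2002, VI §1 Thm. 1.12]
[cite: Gordon1999HodgeAVSurvey, §3 Theorem, 7.5–7.7] -/
theorem cmFamilyRank_add_card_eq_of_twisted_pair_of_real {i₀ i₁ : I} (h01 : i₀ ≠ i₁) (hI : ∀ l, l = i₀ ∨ l = i₁)
    (Φ : ∀ i, CMType (K i)) [Algebra T₀ (K i₀)] [Algebra T₁ (K i₁)]
    (htr₀ : ∀ (a : K i₀ →+* ℂ) (k : K i₀), a k ∈ normalClosure ℚ (K i₁) ℂ → k ∈ Set.range (algebraMap T₀ (K i₀)))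
    (htr₁ : ∀ (b : K i₁ →+* ℂ) (k : K i₁), b k ∈ normalClosure ℚ (K i₀) ℂ → k ∈ Set.range (algebraMap T₁ (K i₁)))
    (y₀ : T₀ →+* ℂ) (y₁ : T₁ →+* ℂ)
    (htw₀ : ∀ y : T₀ →+* ℂ,
      ∑ t ∈ Finset.univ.filter (fun t : K i₀ →+* ℂ => t.comp (algebraMap T₀ (K i₀)) = y),
          antiVec (Φ i₀).1 (1 : ℂ ≃+* ℂ) t =
        (Module.finrank T₀ (K i₀) : ℚ) *
          ((if y = y₀ then 1 else 0) - (if y = (starRingAut : ℂ ≃+* ℂ) • y₀ then 1 else 0)))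
    (htw₁ : ∀ y : T₁ →+* ℂ,
      ∑ t ∈ Finset.univ.filter (fun t : K i₁ →+* ℂ => t.comp (algebraMap T₁ (K i₁)) = y),
          antiVec (Φ i₁).1 (1 : ℂ ≃+* ℂ) t =
        (Module.finrank T₁ (K i₁) : ℚ) *
          ((if y = y₁ then 1 else 0) - (if y = (starRingAut : ℂ ≃+* ℂ) • y₁ then 1 else 0)))
    (hreal : ∀ z : ℂ, z ∈ y₀.toRatAlgHom.fieldRange → z ∈ y₁.toRatAlgHom.fieldRange → starRingEnd ℂ z = z) :
    CMAlgebra.cmFamilyRank Φ + Fintype.card I = (∑ i, cmTypeRank (Φ i)) + 1 := by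
  have hcard : Fintype.card I = 2 := by
    rw [← Finset.card_univ, show (Finset.univ : Finset I) = {i₀, i₁} from Finset.ext fun j => by
      simpa only [Finset.mem_univ, Finset.mem_insert, Finset.mem_singleton, true_iff] using hI j,
      Finset.card_pair h01]
  have hpair := cmTypeRank_add_cmTypeRank_eq_cmFamilyRank_add_one_add_finrank_shadow_inf_shadow h01 hI Φ htr₀ htr₁
  -- the defect space vanishes: invariant under conjugation and odd under it
  have hbot : Submodule.span ℚ (Set.range fun y : T₀ →+* ℂ => fun g : ℂ ≃+* ℂ =>
          ∑ t ∈ Finset.univ.filter (fun t : K i₀ →+* ℂ => t.comp (algebraMap T₀ (K i₀)) = g • y),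
            antiVec (Φ i₀).1 (1 : ℂ ≃+* ℂ) t) ⊓
        Submodule.span ℚ (Set.range fun y : T₁ →+* ℂ => fun g : ℂ ≃+* ℂ =>
          ∑ t ∈ Finset.univ.filter (fun t : K i₁ →+* ℂ => t.comp (algebraMap T₁ (K i₁)) = g • y),
            antiVec (Φ i₁).1 (1 : ℂ ≃+* ℂ) t) = ⊥ := by
    rw [Submodule.eq_bot_iff]
    intro c hc
    obtain ⟨h₀, h₁, hodd⟩ := (mem_twistedShadowCoeff_inf_twistedShadowCoeff_iff Φ y₀ y₁ htw₀ htw₁ c).1 hc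
    funext g
    have hinv := apply_conj_mul_eq_of_left_invariant y₀ y₁ hreal h₀ h₁ g
    have := hodd g
    rw [hinv] at this
    have h0 : c g = 0 := by linarith
    rw [h0, Pi.zero_apply]
  rw [hbot, finrank_bot, add_zero] at hpair
  rw [IrrOdd.sum_eq_add_of_pair _ hI h01, hcard]
  omega

end TwistedPair

end Summit.HodgeConjecture.CorCM

end
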